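import Mathlib
import HarnessLib
import HarnessLib.Audit
import Summits.RiemannHypothesis.Statement
import Literature.NumberTheory.LFunctions.ZetaSpacingDensityRH
import Literature.NumberTheory.LFunctions.ZeroStatistics
import Literature.NumberTheory.LFunctions.SubnormalZetaGapsLOneLowerBound
import Literature.NumberTheory.LFunctions.ZetaGapRecordsRH
import Literature.NumberTheory.LFunctions.ZetaSpacingDensityRHProofs
import Literature.NumberTheory.LFunctions.ZetaGapRecordsInoueNumerics
import HarnessLib.Audit.Status.Attr

/-!
Route: GapsEvoDoors

# Route GapsEvoDoors — gaps-evo doors — the least GUE fragment beyond the diagonal that feeds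
Conrey–Iwaniec, and the resonator-class optimum; FRONTIER rung-route, residual declared

It suffices to show X = X_a ∧ X_a′ ∧ R, a FRONTIER rung-route (director-rh RULINGS G-1/G-2′/G-3,
cell rh-gaps D-0143/D-0145; typed by the cell planner, opened by the paired ideator rh-idea-8). X_a
`FragmentToCI` (door (a), deciding rung): for some finite window Δ the GUE FRAGMENT «F(α,T) → 1
uniformly on 1 < |α| ≤ Δ» plus RH gives Conrey–Iwaniec's hypothesis (1.22)
(`Literature.NumberTheory.LFunctions.SubnormalGapsHypothesis`) — the least such Δ, Δ_CI, is the
cell's pre-registered deliverable (PREREG-GAPS-0 eccf927ec5b416c4 §A, GAPS-4 cc6196fa6726e3ec E5);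
skeleton DeltaCIFinite (the certified extremiser, a pure real-analysis ∃) → FFSpacingCriterionAll
(BGMM Prop 1/Thm 3 with the fragment) → SpacingToCI (bridge: the CI set counts multiple zeros). X_a′
`InOptRung` (door (a′), μ-currency record): modulo Inoue 2026 Thm 2 (tree CLAIM
`inoue2026_theorem2`), RH ⇒ μ ≤ 0.50884 (print 0.508949), from eng-2's class optimum φ*_IN =
0.5088369 (quartic f*, ℓ* = 1.1871; ADDENDUM A1 = PREREG-GAPS-3 cd26ffc3f46dafba); skeleton
(registered stubs, not items) InoueDeduction → InOptCertificate → FStarAdmissible. R `DoorsResidual`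
:= X_a′ → X_a → RH, the DECLARED summit-strength residual (never staffed, exempt from T3/T4; the
route is born FRONTIER and never rendered as distance-to-summit). Both rungs are RH-CONDITIONAL
statements about zeta-zero spacings: neither implies S (spacing statistics never give emptiness off
the line — LindelofBacklund-type obstruction) and S does not give them cheaply (under RH, μ ≤
0.50884 and the fragment criterion are exactly the content).
Lean: `FragmentToCI ∧ InOptRung ∧ DoorsResidual`

## Assembly
WIDE variant: `closes (hk : DeltaCIFinite) (hcrit : FFSpacingCriterionAll) (hb : SpacingToCI) (h₃ :
InOptRung) (hR : DoorsResidual) : Summit.RiemannHypothesis` — five load-bearing binders (BC1 2–6 ✓);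
FragmentToCI is DERIVED inside `closes` from the door-(a) chain (pack the ∃, apply the criterion,
apply the bridge — 4 lines) and is in-cone through DoorsResidual's statement; InOptRung's pieces
(InoueDeduction → InOptCertificate → FStarAdmissible) live as the named stubs of its registered BC3
skeleton, not as items (DensityLadder precedent). The Assembly item is the POINTWISE form (any level
φ ≤ 0.50884, any window Δ ≥ 1), provable now by `ZetaGapLiminfLe.mono` and packing the ∃ (Sketch
`assembly_holds`).

Rationale: WHY THIS LINE. D-0143 made the gaps-evo cell a SEARCH cell whose outputs are objects (D-0116): door
(a) searches pair-correlation test functions beyond the Montgomery–Odlyzko class, door (a′)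
optimises inside printed resonator theorems, and every number exists from two code-disjoint engines
with a referee (computed ≠ proved). The referee's falsifier F-A0 (AH half-lattice dual;
Lagarias–Rodgers arXiv:1905.12123, Baluyot–Goldston–Suriajaya–Turnage-Butterbaugh arXiv:2508.10857
p.3) proves that on the inputs {RH, Montgomery's theorem on [−1,1], F ≥ 0, GRH-GGOS, band-limited
n-level} NO test function certifies sub-half spacings, so director RULING G-1 (b) fixed the door-(a)
currency as the LEAST NAMED AH-REFUTING INPUT — a fragment of F beyond the diagonal — that makes the
BGMM 2023 (arXiv:2208.02359) → Conrey–Iwaniec 2002 chain fire; this route types that chain once for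
all windows (FFSpacingCriterionAll), removes the printed N* loss by observing that CI's set counts
multiple zeros (SpacingToCI; tree `HasCloseCriticalNeighbour`), and isolates the search object as
one ∃-statement of real analysis (DeltaCIFinite). Door (a′) banks eng-2's optimisation of Inoue 2026
Thm 2's class (arXiv:2604.05733; tree `Inoue2026.M`, `inoue2026_numericalBound_holds`) as a record
rung whose only non-routine input is one closed-form inequality. Imported areas:
Beurling–Selberg/Delsarte extremal functions (Carneiro–Chandee–Littmann–Milinovich arXiv:1406.5462,
Chirre–Gonçalves–de Laat arXiv:1810.08843), random-matrix form factors, certified numerics. What it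
does that prior routes do not: no RH route of this hub touches zero SPACINGS
(IntegerScrew/DensityLadder/Li*/Jensen* are positivity, density or coefficient ladders); the
negatives index (4 entries: ShiftedResolvent ×2, CharacterSums, UniversalFactor) is unrelated.

RANKED CRUXES. #2 FragmentToCI (crux) — for some window Δ ≥ 1: if F(α,T) → 1 uniformly on 1 < |α| ≤
Δ (every ε > 0, all large T), then RH and one close pair below height 2001 give ∃ c > 0,
SubnormalGapsHypothesis c (Conrey–Iwaniec (1.22)). Δ_CI := least such Δ (PREREG-GAPS-0 §A / GAPS-4
E5; instrument rows: eng-1 GP runs, eng-2 LP/SDP runs, referee Λ_dual(Δ)). [difficulty: L] (why it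
might fail: with F pinned only on a bounded window and r̂ ≥ 0 forced beyond Δ, the certifiable
sub-half pair mass may stay ≤ 0 for EVERY Δ (GUE has only ≈ 0.229 ordered pair mass inside |u| ≤
1/2; Paley–Wiener rigidity of one-sided extremal problems) — then Δ_CI = ∞ and the rung is empty.)
[arXiv:2208.02359, BuiEtAl2023, ConreyIwaniec2002, arXiv:1905.12123, arXiv:2508.10857,
arXiv:1810.08843, Montgomery1973] — STATUS: CLOSED AS PROVED 2026-08-28T00:19:12Z by
Theorems.GapsEvoDoorsWindow.FragmentToCI_holds (eng-2 g2, p589048): the registered FLOOR-skeleton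
composition from tree theorems only — DeltaCIFloorNineTenths_holds (p587111, Fejér triangle (100,
499/1000, 89/100)) + FloorSpacingCriterionAll_holds (p588630, window form of BGMM Prop 1 + Thm 3:
GapsEvoDoorsWindowPairCount p588002, GapsEvoDoorsWindowCriterion p588273) + SpacingToCI_holds
(p587571, prover-1); skeleton 1 is also complete (DeltaCIFinite_holds p586817 Selberg-minorant
witness (100/49, 1/20, 49/100) + second witness sinc⁴ family p588113; FFSpacingCriterionAll_holds
p589400). The kernel window is Δ = 100 (resp. 100/49); the certified Δ_CI(ε) ≤ 1.34…1.63 and the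
record cells stay computed ≠ proved until a kernel witness at that window lands. No expansion
(director RULING G-6; 15-item cap).
#3 InOptRung (crux) — modulo Inoue 2026 Theorem 2 (tree CLAIM, preprint under review), on RH the lim
inf of normalised gaps satisfies μ ≤ 0.50884 (print: μ ≤ 0.508949 with the linear f₀, ℓ = 1.15;
eng-2 tf2-g0-r1 j289119: class optimum 0.5088369 with the quartic f*, ℓ* = 1.1871, degrees 6/8
identical; ADDENDUM A1 = PREREG-GAPS-3; instrument rows j289119/j289121 + eng-1 replicate
R-aIN-E1-g0-01). [difficulty: M] (why it might fail: the margin at φ = 0.50884 is ≈ 5·10⁻⁶ from ONE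
engine's float optimum with coefficients rounded to 5 decimals — the certified interval evaluation
(referee, then in-kernel) may come out below 10⁻⁶, pushing φ_cert to 0.50885+; and Thm 2 itself is
an unrefereed claim.) [arXiv:2604.05733, Inoue2026, BuiMilinovichNg2010, arXiv:2501.01223] — STATUS:
CLOSED AS PROVED 2026-08-27T23:16:47Z by Theorems.GapsEvoDoorsInOpt.InOptRung_holds (eng-1 in-kernel
certificate `inOpt_certificate` at ℓ = 19/16, φ = 0.50884; modules p581442 · p581942 · p582483 ·
p582827 · p583257 · p583697 · p584291); no expansion follows (director RULING G-6; D-0019 15-item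
cap).
#7 DoorsResidual (crux) — [residual — declared summit-strength complement BY DESIGN, never a prover
target, exempt from T3/T4; kind crux only so that the deciding theorem assumes crux items only] the
two rungs imply RH. It names what the doors do not reach: zero-spacing statistics and conditional
gap records never give emptiness off the critical line. [deps: FragmentToCI, InOptRung] [difficulty:
open-problem] (why it might fail: it is summit-strength by design (both rungs are believed true, so
it is equivalent to RH); closing it = proving RH from spacing statistics, which
LindelofBacklund-type counting obstructions forbid; recorded on the residual ledger, not a target.)
[ConreyIwaniec2002, arXiv:2208.02359, Ivic1985]
#9 DeltaCIFinite (support) — the door-(a) SEARCH OBJECT as a statement (stub of FragmentToCI;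
decided by a certified extremiser — two engines + referee): some window Δ ≥ 1, slack ε > 0, λ < 1/2
and r ∈ 𝒜_Δ(λ) (even, continuous, integrable, r ≤ 1, r ≤ 0 off [−λ,λ], r̂ integrable, r̂ ≥ 0 for |α|
≥ Δ) have certificate c(r;Δ,ε) = r̂(0) − 1 + 2∫₀¹αr̂ + 2∫₁^Δ((1−ε)r̂⁺ − (1+ε)r̂⁻) > 0. [difficulty:
M] [arXiv:2208.02359, arXiv:1810.08843, arXiv:1406.5462]
#9 FFSpacingCriterionAll (support) — (stub of FragmentToCI; provable now) BGMM 2023 Prop 1 / Thm 3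
first clause with F pinned to 1 ± ε on 1 < |α| ≤ Δ: for every Δ ≥ 1, ε ≥ 0, the fragment and RH turn
a positive certificate c(r;Δ,ε) at λ into SpacingDensityPos λ; at Δ = 1 with r̂ ≥ 0 everywhere it is
the tree theorem BGMM2023.spacingDensityPos_of_RH. [difficulty: M] [arXiv:2208.02359, BuiEtAl2023,
Montgomery1973]
#9 SpacingToCI (support) — (stub of FragmentToCI; provable now; PREREG-GAPS-4 E5) on RH a positive
density of spacings WITH multiplicity below λ₀ < 1/2, plus one close pair below height 2001, gives ∃
c > 0, SubnormalGapsHypothesis c — because CI's set counts multiple zeros (tree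
HasCloseCriticalNeighbour); Cauchy–Schwarz with Σ m(γ)² ≤ Σ W² ≪ N(T)
(BGMM2023.sum_windowCount_pow_le_count_of_RH) and the ciRadius bookkeeping of
BGMM2023.le_ncard_closeCriticalZeros_of_gapDensityPos. [difficulty: provable-now]
[ConreyIwaniec2002, arXiv:2208.02359]

TWO-LAYER PLAN. DONE for both doors and for the door-(a″) record chain: FragmentToCI closed by the
floor skeleton {DeltaCIFloorNineTenths ✓, FloorSpacingCriterionAll ✓, SpacingToCI ✓} (skeleton 1
{DeltaCIFinite ✓, FFSpacingCriterionAll ✓, SpacingToCI ✓} is complete too); InOptRung closed by the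
in-kernel certificate; the door-(a″) supports are tree theorems as well — SimpleFromNStar ✓
(p588693), FFMultiplicityCriterionAll ✓ (p589496, GapsEvoDoorsFF.FFMultiplicityCriterionAll_holds:
explicit formula against a signed window majorant (1+ε)ĝ⁺ − (1−ε)ĝ⁻, tail dropped by F ≥ 0 ∧ ĝ ≤ 0;
referee V-27) and MultCertificateRecord ✓ (p590932,
GapsEvoDoorsMultCert.MultCertificateRecord_holds, referee V-29/V-30 std axioms: the
Montgomery–Taylor cosine-pulse witness h = cos(πt/2)·𝟙_{|t| ≤ 53/100}, ĝ = h∗h/ĥ(0)² ≥ 0 on [−53/50,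
53/50] and ≡ 0 beyond, m(53/50, 0) = 1.2901372410 ≤ 1293/1000, κ = 0.0019644166 — FOUR independent
evaluations agree to every digit: prover-1, eng-2 THIRD-EVAL 91691b21cc47bb0d, referee V-28, planner
g1) ⇒ the record composition FragmentToSimpleRecord «RH + [F(α,T) → 1 uniformly on 1 < |α| ≤ 53/50]
⇒ eventually (704/1000 − η)·N(T) ≤ N_simple(T) for every η > 0» IS a tree implication end to end:
the aside FragmentToSimpleRecord ✓ (p591649, GapsEvoDoorsSimpleRecord.FragmentToSimpleRecord_holds;
composition with ε = η/(3(κ+1))) — a RECORD landing, never progress (the RH record it sits above is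
Bui–Heath-Brown's 19/27; the cell's sharper Δ_s ≤ 1.0506 stays computed ≠ proved). The Assembly ✓ is
closed too (p591960, GapsEvoDoorsAssembly.Assembly_holds: the pointwise hypotheses at φ ≤ 0.50884, Δ
≥ 1 pack into InOptRung by ZetaGapLiminfLe.mono and into FragmentToCI by ∃-packing, and the declared
residual concludes — bookkeeping only). CLOSED·PROVED 12/15, all with referee custody (standard
axioms) through 23131 and successor custody for the last two. What remains open is by design and is
NEVER staffed: the residual R (DoorsResidual, summit-strength: «the two rungs imply RH») and the two
asides InoueTheoremTwo (= the preprint's Theorem 2 itself, a CLAIM under refereeing) and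
FragmentCertificateWall13 (the conjectured lower wall Δ_CI(ε) > 1.3; dual v7 gives soft walls only)
— the route's DESIGNED TERMINAL STATE «everything but R» is REACHED (RECORD/FRONTIER class; toward
RiemannHypothesis: 0). Nothing is provable-now; no expansion follows (director RULING G-6; D-0019
15-item cap). Nothing is ever filed on route-RiemannHypothesis-IntegerScrew (RULING G-2′ (i)).

KILL CRITERIA. Every non-residual item is now a kernel theorem with standard axioms, so no refuter
verdict on an item can kill the route any more; what can still happen is classed as follows. (i)
VACUITY of a rung's hypothesis: FragmentToCI / FragmentToSimpleRecord assume the GUE fragment F(α,T)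
→ 1 on a window beyond the diagonal (Δ = 100 in the kernel witness of FragmentToCI, 53/50 for the
simple-zero record) together with RH — an AH-refuting input by design (F-A0); a theorem showing RH ⇒
¬(fragment on (1, Δ]) for such a Δ would make that rung VACUOUS (true but empty) ⇒ the planner
re-labels the rung «vacuous under RH» in the books and the docstring (--reinformal), files nothing
new, and the door's record numbers lose their meaning; no such theorem is known or expected (GUE
predicts F ≡ 1 there; Montgomery's conjecture). (ii) The conditional input of InOptRung is the tree
hypothesis `inoue2026_theorem2` (aside InoueTheoremTwo = the claim itself): Inoue 2026 Thm 2
withdrawn/refuted in print ⇒ InOptRung stays a true implication with a false antecedent — re-label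
«moot», nothing to repair. (iii) LEDGER CLASS: a tribunal or digest counting R (DoorsResidual) or
the record composition as distance-to-summit ⇒ mis-ledgered; the route is FRONTIER/RECORD class and
must stay so (toward RiemannHypothesis: 0). (iv) The emptiness kill path for door (a) is RETIRED
(PREREG-GAPS-10 E12′; aside FragmentCertificateWall8 dropped rev 7 as numerically false;
DeltaCIFinite / DeltaCIFloorNineTenths have kernel witnesses). The conjectured lower wall (aside
FragmentCertificateWall13, «Δ_CI(ε) > 1.3») is NOT a kill criterion: the referee dual v7 gives only
SOFT walls (Δ = 1.2 to λ = 0.50, Δ = 1.3 to 0.47; V-18).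

NOT DECOMPOSED YET. Nothing, and nothing will be: every foreseen layer-2 lemma has landed (window
pair count p588002, window criterion p588273, signed-Montgomery window lemma GapsEvoDoorsFFWindow
p588840, ordinate/multiplicity bookkeeping in SpacingToCI, SimpleFromNStar p588693, the
Montgomery–Taylor objects GapsEvoDoorsMT{Defs,Fourier,Integrals} p589690/p590457/p590507). Optional
kernel upgrades that are NOT items and NOT sought (cap; G-6): a witness for DeltaCIFinite at the
record cell (3/2, 1/20) from W2-EXACT (integer two-square object), a witness for
DeltaCIFloorNineTenths at (2, 17/20, 12/25), the average-floor port (AntitoneOn hypothesis) of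
FloorSpacingCriterionAll, an M–T-family witness at Δ_s ≈ 1.0487. R is never decomposed (residual);
InoueTheoremTwo closes only by a kernel formalisation of Inoue 2026 Thm 2 (not this cell's);
FragmentCertificateWall13 only by a certified dual wall (not sought).

CHEAPEST FALSIFIER. Executed for every item that closed: the referee's falsifier-first read of every
typed support (V-21/V-25/V-27: no misstatement; sign conventions ≡ BGMM Prop 1 on both the minorant
and the majorant side), Lean custody of every closer (#print axioms standard: V-19…V-30; successor
referee prints 22424/23132), third/fourth-evaluator re-derivation of every witness constant
(0.0224620 / 0.0331978 / 0.0092794 / c_fl cells / m(53/50, 0) = 1.2901372410), dual v7 falsifier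
rows (all PASS). Nothing provable-now remains to falsify; the residual R is not a target, and the
asides carry their own words (InoueTheoremTwo: the preprint's refereeing; FragmentCertificateWall13:
a certified dual wall above 1.3 would PROVE it, a certificate at Δ ≤ 1.3 would REFUTE it — neither
is sought (G-6)).

Novelty: Searches (2026-08-27, cell planner; both corpora): `lit search --hybrid "pair correlation form
factor beyond diagonal small gaps zeta positive proportion" -n 10` ([corpus:paper:arxiv-2208.02359
p0003/p0008], [corpus:paper:arxiv-1810.08843 p0004], [corpus:paper:arxiv-2310.01913 p0004]); `lit
search "Conrey Iwaniec spacing zeros L-functions class number" ` ([corpus: ConreyIwaniec2002]);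
eng-2/idea-crit reading of [corpus:paper:arxiv-1905.12123 p0009] (AH agreement ceases beyond [−1,1])
and arXiv:2508.10857 p.3; ls-idea §I6 INPUT MAP row (b) (pub/ls-idea/cards/ls-idea-lens-6.md l.77:
F-fragments are AH-sensitive and (A)-refuting in print); tree: no RH route mentions
SpacingDensityPos / ZetaGapLiminfLe / SubnormalGapsHypothesis (rg over
Summits/RiemannHypothesis/RiemannHypothesis/Theses: 0 hits).
Nearest prior art found: BuiEtAl2023 (arXiv:2208.02359) Thm 3 + its tree bridge
`subnormalGapsHypothesis_of_gapDensityPos` (Δ = 1, distinct gaps, N* loss 0.3208); Conrey–Iwaniec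
2002 §1 p.3 remark (full PCC ⇒ (1.22)); Inoue 2026 Remark 1 (optimising f gives a slight gain).
Delta: the route quantifies HOW LITTLE of the pair-correlation conjecture beyond the diagonal the
BGMM→CI chain needs (a finite window Δ_CI instead of full PCC), prices it without the N* loss
(multiple zeros count for CI), and turns both doors' numerics into typed, certifiable statements.
Claimed grade: new-combination  [refs: 2508.10857, 2208.02359, paper:arxiv-2208.02359, paper:arxiv-1810.08843, paper:arxiv-2310.01913, paper:arxiv-1905.12123, ConreyIwaniec2002, BuiEtAl2023]

Barriers (technique_class: pair-correlation delsarte-extremal resonance-method): - technique_class: pair-correlation delsarte-extremal resonance-method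
- Literature.Barriers.RiemannHypothesis.LindelofBacklund: applies to the RESIDUAL only (zero
statistics / counts never give emptiness): R is declared residual and never staffed; the rungs do
not claim S.
- AH wall F-A0 (tree Literature/NumberTheory/LFunctions/AlternativeHypothesis*.lean,
Lagarias–Rodgers; referee REFEREE-FALSIFIER-A0 42fda3b858e40a47): inside — every AH-consistent input
gives c ≤ 0 at λ ≤ 1/2; FragmentToCI evades it ONLY by its named AH-refuting hypothesis (the
fragment), which is the point of the rung (least such input), not a claim to have beaten the wall.
- Montgomery–Odlyzko limitation (tree `goldstonTrudgianTurnageButterbaugh2023_theorem1`, 0.5042;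
`inoueKobayashiToma2025_theorem3`, 0.508): InOptRung sits INSIDE the resonance class and above both
floors (0.50884 > 0.508) — consistent, no evasion claimed; it is a record rung, not the CI door.
- Negatives index: 4 refuted RH statements (ShiftedResolvent ×2, CharacterSums Conrey positivity,
UniversalFactor Laplace loophole) — none concerns zero spacings; nothing here restates them.

History (route lifecycle, newest last):
- 2026-08-27T22:11:54Z · rev 7: dropped FragmentCertificateWall8 — drop aside 22917 FragmentCertificateWall8 (never in the cone of closes; banked context only): the critic of record idea-crit-2 WITHDREW its PRICE (2) kill path (planner-rh-idea-8-g0-0)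
- 2026-08-27T22:37:57Z · rev 10: informal re-worded for MultCertificateRecord (planner-rh-gaps-plan-g0-0)
- 2026-08-27T22:38:54Z · rev 11: informal re-worded for DeltaCIFloorNineTenths (planner-rh-gaps-plan-g0-0)
- 2026-08-27T23:29:28Z · rev 13: informal re-worded for DeltaCIFloorNineTenths (planner-rh-gaps-plan-g0-0)
- 2026-08-27T23:30:45Z · rev 14: informal re-worded for FloorSpacingCriterionAll (planner-rh-gaps-plan-g0-0)
- 2026-08-28T02:00:36Z · rev 17: informal re-worded for DeltaCIFinite (planner-rh-gaps-plan-g1-0)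
- 2026-08-28T02:01:33Z · rev 18: informal re-worded for DeltaCIFloorNineTenths (planner-rh-gaps-plan-g1-0)
- 2026-08-28T02:18:12Z · rev 19: informal re-worded for FragmentToCI (planner-rh-gaps-plan-g1-0)

sub-problem: RiemannHypothesis · status: draft · opened planner-rh-idea-8-g0-0 2026-08-27T20:48:57Z · rev 19 · ledger route-RiemannHypothesis-GapsEvoDoors
GENERATED by the gate from the ledger (D-0016/17). Provers cite these decls: `theorem foo : Summit.RiemannHypothesis.RiemannHypothesis.Theses.GapsEvoDoors.<Decl> := …` in Summits/RiemannHypothesis/RiemannHypothesis/Theorems/<Name>.lean.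
-/

namespace Summit.RiemannHypothesis.RiemannHypothesis.Theses.GapsEvoDoors

open scoped BigOperators Topology Manifold Classical MeasureTheory ProbabilityTheory Matrix InnerProductSpace ComplexConjugate ContinuousMap
open Filter Set Function TopologicalSpace MeasureTheory

attribute [summit_statement] _root_.Summit.RiemannHypothesis

open Summit

/-- item stmt-RiemannHypothesis-22418 · crux · rank 2 · closed · proved by Summit.RiemannHypothesis.RiemannHypothesis.Theorems.GapsEvoDoorsWindow.FragmentToCI_holds (prover) · by planner
why it might fail: with F pinned only on a bounded window and r̂ ≥ 0 forced beyond Δ, the certifiable sub-half pair mass may stay ≤ 0 for EVERY Δ (GUE has only ≈ 0.229 ordered pair mass inside |u| ≤ 1/2; Paley–Wiener rigidity of one-sided extremal problems) — then Δ_CI = ∞ and the rung is empty.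
sources: arXiv:2208.02359, BuiEtAl2023, ConreyIwaniec2002, arXiv:1905.12123, arXiv:2508.10857, arXiv:1810.08843
[crux] for some window Δ ≥ 1: if F(α,T) → 1 uniformly on 1 < |α| ≤ Δ (every ε > 0, all large T),
then RH and one close pair below height 2001 give ∃ c > 0, SubnormalGapsHypothesis c (Conrey–Iwaniec
(1.22)). Δ_CI := least such Δ (PREREG-GAPS-0 §A / GAPS-4 E5; instrument rows: eng-1 GP runs, eng-2
LP/SDP runs, referee Λ_dual(Δ)). [difficulty: L] CLOSED by `GapsEvoDoorsWindow.FragmentToCI_holds`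
(p589048; floor skeleton 23031 + 23032 + 22423, window of the floor witness Δ = 100; referee V-25,
axioms standard). EXPLICIT KERNEL WINDOWS (supports file
Theorems/GapsEvoDoorsFragmentToCIWindows.lean, p596320, prover-1 g3 2026-08-28; compositions of the
record-cell kernel witnesses with FFSpacingCriterionAll_holds + SpacingToCI_holds through
`GapsEvoDoorsWindow.fragmentToCI_of_certificate`):
`GapsEvoDoorsWindow.fragmentToCI_window_threeHalves` — if eventually |F(α,T) − 1| ≤ 1/20 on 1 < |α|
≤ 3/2, then RH and one close pair below 2001 give ∃ c > 0, SubnormalGapsHypothesis c (witness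
`GapsEvoDoorsW2.DeltaCIFinite_recordCell`, eng-2's W₂-EXACT object at (3/2, 1/20, 99/200), p595462,
referee V-32); `GapsEvoDoorsWindow.fragmentToCI_at_threeHalves` — the crux's own ∀ε-fragment
hypothesis on the wi -/
@[route_item "route-RiemannHypothesis-GapsEvoDoors"]
def FragmentToCI : Prop :=
  ∃ Δ : ℝ, 1 ≤ Δ ∧ ((∀ ε : ℝ, 0 < ε → ∃ T₀ : ℝ, ∀ T : ℝ, T₀ ≤ T → ∀ α : ℝ, 1 < |α| → |α| ≤ Δ → |Literature.NumberTheory.LFunctions.montgomeryFormFactor α T - 1| ≤ ε) → _root_.RiemannHypothesis → (Literature.NumberTheory.LFunctions.closeCriticalZeros 2001).Nonempty → ∃ c : ℝ, 0 < c ∧ Literature.NumberTheory.LFunctions.SubnormalGapsHypothesis c)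

-- `FragmentToCI` holds: proved by `Summit.RiemannHypothesis.RiemannHypothesis.Theorems.GapsEvoDoorsWindow.FragmentToCI_holds` (its module imports this route file, so no `_holds` link can be stated here).

/-- item stmt-RiemannHypothesis-22419 · crux · rank 3 · closed · proved by Summit.RiemannHypothesis.RiemannHypothesis.Theorems.GapsEvoDoorsInOpt.InOptRung_holds (prover) · by planner
why it might fail: the margin at φ = 0.50884 is ≈ 5·10⁻⁶ from ONE engine's float optimum with coefficients rounded to 5 decimals — the certified interval evaluation (referee, then in-kernel) may come out below 10⁻⁶, pushing φ_cert to 0.50885+; and Thm 2 itself is an unrefereed claim.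
sources: arXiv:2604.05733, Inoue2026, BuiMilinovichNg2010, arXiv:2501.01223
[crux] modulo Inoue 2026 Theorem 2 (tree CLAIM, preprint under review), on RH the lim inf of
normalised gaps satisfies μ ≤ 0.50884 (print: μ ≤ 0.508949 with the linear f₀, ℓ = 1.15; eng-2
tf2-g0-r1 j289119: class optimum 0.5088369 with the quartic f*, ℓ* = 1.1871, degrees 6/8 identical;
ADDENDUM A1 = PREREG-GAPS-3; instrument rows j289119/j289121 + eng-1 replicate R-aIN-E1-g0-01).
[difficulty: M] -/
@[route_item "route-RiemannHypothesis-GapsEvoDoors", crux]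
def InOptRung : Prop :=
  Literature.NumberTheory.LFunctions.inoue2026_theorem2 → _root_.RiemannHypothesis → Literature.NumberTheory.LFunctions.ZetaGapLiminfLe 0.50884

-- `InOptRung` holds: proved by `Summit.RiemannHypothesis.RiemannHypothesis.Theorems.GapsEvoDoorsInOpt.InOptRung_holds` (its module imports this route file, so no `_holds` link can be stated here).

/-- item stmt-RiemannHypothesis-22420 · crux · rank 7 · open · by planner
why it might fail: it is summit-strength by design (both rungs are believed true, so it is equivalent to RH); closing it = proving RH from spacing statistics, which LindelofBacklund-type counting obstructions forbid; recorded on the residual ledger, not a target.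
sources: ConreyIwaniec2002, arXiv:2208.02359, Ivic1985
[crux] [residual — declared summit-strength complement BY DESIGN, never a prover target, exempt from
T3/T4; kind crux only so that the deciding theorem assumes crux items only] the two rungs imply RH.
It names what the doors do not reach: zero-spacing statistics and conditional gap records never give
emptiness off the critical line. [deps: FragmentToCI, InOptRung] [difficulty: open-problem] -/
@[route_item "route-RiemannHypothesis-GapsEvoDoors", crux]
def DoorsResidual : Prop :=
  InOptRung → FragmentToCI → Summit.RiemannHypothesis

/-- item stmt-RiemannHypothesis-22421 · support · rank 9 · closed · proved by Summit.RiemannHypothesis.RiemannHypothesis.Theorems.GapsEvoDoorsDeltaCI.DeltaCIFinite_holds (prover) · by planner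
sources: arXiv:2208.02359, arXiv:1810.08843, arXiv:1406.5462
[support] the door-(a) SEARCH OBJECT as a statement (stub of FragmentToCI; decided by a certified
extremiser — two engines + referee): some window Δ ≥ 1, slack ε > 0, λ < 1/2 and r ∈ 𝒜_Δ(λ) (even,
continuous, integrable, r ≤ 1, r ≤ 0 off [−λ,λ], r̂ integrable, r̂ ≥ 0 for |α| ≥ Δ) have certificate
c(r;Δ,ε) = r̂(0) − 1 + 2∫₀¹αr̂ + 2∫₁^Δ((1−ε)r̂⁺ − (1+ε)r̂⁻) > 0. [difficulty: M] WITNESS OF RECORD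
for DeltaCIFinite (cell rh-gaps 2026-08-27; PREREG-GAPS-0 eccf927ec5b416c4 §A.5; instrument rows
R-aA1-E2-g0-01-cert #6 and R-aA1-E1-g0-03/certify_exact #2; referee V-9/V-10/V-11, VERDICTS
136f9b8b8723c08a): (Δ, ε, λ) = (3/2, 1/20, 0.48381 — exact window in certificates.json), r(u) = (λ²
− u²)·Σ_i w_i h_i(u)², ĥ_i(x) = Σ_j v_ij (1 − x²) P_2j(x), x = 2ξ/K (PW-SOS, K and n = 14 as in
certificates.json, MANIFEST 76b1852184076c27): c(r; 3/2, 1/20) ≥ 5.0e-3 (∈ [0.0050153, 0.0050170])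
by exact rational polynomial algebra + 40-digit interval arithmetic (eng-2), independently
RE-DERIVED by the referee (V-11); second, code-disjoint certified witness (eng-1): (Δ, ε, λ) = (7/5,
1/20, 0.4999), r = P(t)e^(−πt)/M with exact rational P of degree ≤ 9, c ≥ 2.1669e-3 (certify_exact
folder 52ea84d8f8e37a74; thi -/
@[route_item "route-RiemannHypothesis-GapsEvoDoors", crux]
def DeltaCIFinite : Prop :=
  ∃ (Δ ε lam : ℝ) (r : ℝ → ℝ), 1 ≤ Δ ∧ 0 < ε ∧ 0 < lam ∧ lam < 1 / 2 ∧ (∀ u : ℝ, r (-u) = r u) ∧ Continuous r ∧ MeasureTheory.Integrable r ∧ MeasureTheory.Integrable (Literature.NumberTheory.LFunctions.BGMM2023.cosTransform r) ∧ (∀ u : ℝ, r u ≤ 1) ∧ (∀ u : ℝ, lam < |u| → r u ≤ 0) ∧ (∀ α : ℝ, Δ ≤ |α| → 0 ≤ Literature.NumberTheory.LFunctions.BGMM2023.cosTransform r α) ∧ 0 < Literature.NumberTheory.LFunctions.BGMM2023.cosTransform r 0 - 1 + 2 * (∫ α in (0 : ℝ)..1, α * Literature.NumberTheory.LFunctions.BGMM2023.cosTransform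 r α) + 2 * (∫ α in (1 : ℝ)..Δ, ((1 - ε) * max (Literature.NumberTheory.LFunctions.BGMM2023.cosTransform r α) 0 - (1 + ε) * max (-Literature.NumberTheory.LFunctions.BGMM2023.cosTransform r α) 0))

-- `DeltaCIFinite` holds: proved by `Summit.RiemannHypothesis.RiemannHypothesis.Theorems.GapsEvoDoorsDeltaCI.DeltaCIFinite_holds` (its module imports this route file, so no `_holds` link can be stated here).

/-- item stmt-RiemannHypothesis-22422 · support · rank 9 · closed · proved by Summit.RiemannHypothesis.RiemannHypothesis.Theorems.GapsEvoDoorsWindow.FFSpacingCriterionAll_holds (prover) · by planner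
sources: arXiv:2208.02359, BuiEtAl2023, Montgomery1973
[support] (stub of FragmentToCI; provable now) BGMM 2023 Prop 1 / Thm 3 first clause with F pinned
to 1 ± ε on 1 < |α| ≤ Δ: for every Δ ≥ 1, ε ≥ 0, the fragment and RH turn a positive certificate
c(r;Δ,ε) at λ into SpacingDensityPos λ; at Δ = 1 with r̂ ≥ 0 everywhere it is the tree theorem
BGMM2023.spacingDensityPos_of_RH. [difficulty: M] -/
@[route_item "route-RiemannHypothesis-GapsEvoDoors", crux]
def FFSpacingCriterionAll : Prop :=
  ∀ Δ ε : ℝ, 1 ≤ Δ → 0 ≤ ε → (∃ T₀ : ℝ, ∀ T : ℝ, T₀ ≤ T → ∀ α : ℝ, 1 < |α| → |α| ≤ Δ → |Literature.NumberTheory.LFunctions.montgomeryFormFactor α T - 1| ≤ ε) → _root_.RiemannHypothesis → ∀ (lam : ℝ) (r : ℝ → ℝ), 0 < lam → (∀ u : ℝ, r (-u) = r u) → Continuous r → MeasureTheory.Integrable r → MeasureTheory.Integrable (Literature.NumberTheory.LFunctions.BGMM2023.cosTransform r) → (∀ u : ℝ, r u ≤ 1) → (∀ u : ℝ, lam < |u|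 → r u ≤ 0) → (∀ α : ℝ, Δ ≤ |α| → 0 ≤ Literature.NumberTheory.LFunctions.BGMM2023.cosTransform r α) → 0 < Literature.NumberTheory.LFunctions.BGMM2023.cosTransform r 0 - 1 + 2 * (∫ α in (0 : ℝ)..1, α * Literature.NumberTheory.LFunctions.BGMM2023.cosTransform r α) + 2 * (∫ α in (1 : ℝ)..Δ, ((1 - ε) * max (Literature.NumberTheory.LFunctions.BGMM2023.cosTransform r α) 0 - (1 + ε) * max (-Literature.NumberTheory.LFunctions.BGMM2023.cosTransform r α) 0)) → Literature.NumberTheory.LFunctions.BGMM2023.SpacingDensityPos lam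

-- `FFSpacingCriterionAll` holds: proved by `Summit.RiemannHypothesis.RiemannHypothesis.Theorems.GapsEvoDoorsWindow.FFSpacingCriterionAll_holds` (its module imports this route file, so no `_holds` link can be stated here).

/-- item stmt-RiemannHypothesis-22423 · support · rank 9 · closed · proved by Summit.RiemannHypothesis.RiemannHypothesis.Theorems.GapsEvoDoorsSpacingToCI.SpacingToCI_holds (prover) · by planner
sources: ConreyIwaniec2002, arXiv:2208.02359
[support] (stub of FragmentToCI; provable now; PREREG-GAPS-4 E5) on RH a positive density of
spacings WITH multiplicity below λ₀ < 1/2, plus one close pair below height 2001, gives ∃ c > 0,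
SubnormalGapsHypothesis c — because CI's set counts multiple zeros (tree HasCloseCriticalNeighbour);
Cauchy–Schwarz with Σ m(γ)² ≤ Σ W² ≪ N(T) (BGMM2023.sum_windowCount_pow_le_count_of_RH) and the
ciRadius bookkeeping of BGMM2023.le_ncard_closeCriticalZeros_of_gapDensityPos. [difficulty:
provable-now] -/
@[route_item "route-RiemannHypothesis-GapsEvoDoors", crux]
def SpacingToCI : Prop :=
  _root_.RiemannHypothesis → ∀ lam : ℝ, 0 ≤ lam → lam < 1 / 2 → Literature.NumberTheory.LFunctions.BGMM2023.SpacingDensityPos lam → (Literature.NumberTheory.LFunctions.closeCriticalZeros 2001).Nonempty → ∃ c : ℝ, 0 < c ∧ Literature.NumberTheory.LFunctions.SubnormalGapsHypothesis c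

-- `SpacingToCI` holds: proved by `Summit.RiemannHypothesis.RiemannHypothesis.Theorems.GapsEvoDoorsSpacingToCI.SpacingToCI_holds` (its module imports this route file, so no `_holds` link can be stated here).

/-- item stmt-RiemannHypothesis-22919 · aside · rank 9 · open · by planner
[support] the tree CLAIM `inoue2026_theorem2` (Inoue 2026, arXiv:2604.05733, Theorem 2 —
resonator-class criterion for small normalised gaps on RH; preprint under review, typed cite-only in
ZetaGapRecordsRH.lean) declared as a route item so that the cone of `closes` has no undeclared claim
leaf (route show 21:34Z: «staffable NO — 1 unproved dep in the cone: inoue2026_theorem2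
[cite_only]»). InOptRung (22419) is stated MODULO this claim and stays so; this item closes only by
a kernel formalisation of Inoue Theorem 2 (Bui–Milinovich–Ng 2010 resonator framework + Inoue §3),
difficulty M/L, never by citation; planner of record (rh-gaps-plan) may re-badge it aside. Sources:
arXiv:2604.05733, BuiMilinovichNg2010, arXiv:2501.01223. Nothing here bears on the truth of RH. -/
@[route_item "route-RiemannHypothesis-GapsEvoDoors"]
def InoueTheoremTwo : Prop :=
  Literature.NumberTheory.LFunctions.inoue2026_theorem2

/-- item stmt-RiemannHypothesis-23031 · support · rank 9 · closed · proved by Summit.RiemannHypothesis.RiemannHypothesis.Theorems.GapsEvoDoorsFloor.DeltaCIFloorNineTenths_holds (prover) · by planner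
sources: arXiv:2208.02359, arXiv:1810.08843, arXiv:1406.5462
[support] LINE L11-a3 «FLOOR FRAGMENT» search object at floor f₀ = 9/10 (cell rh-gaps
lines/Sketch.lean `DeltaCIFloor (9/10)`, expanded verbatim; planner of record rh-gaps-plan): some
window Δ ≥ 1, some λ < 1/2, some 0 ≤ f < 9/10 and some r ∈ 𝒜_Δ(λ) (the seven clauses of
DeltaCIFinite) with r̂ ≥ 0 on 1 ≤ |α| ≤ Δ have floor certificate c_fl(r;Δ,f) = r̂(0) − 1 + 2∫₀¹αr̂ +
2f∫₁^Δ r̂ > 0. Pure real analysis, engine-decidable; stub of the SECOND registered skeleton on crux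
FragmentToCI (floor fragment ⇒ CI; composition fragmentToCI_of_floor kernel-checked); a floor
certificate at f is a two-sided certificate at every ε ≤ 1 − f (23031 ⟹ 22421). WITNESS CELL OF
RECORD (Δ, f, λ) = (2, 17/20, 12/25) — TWO-ENGINE CERTIFIED·AGREE (referee V-17/V-20, VERDICTS.md
03fff6c81249b658): W = eng-2 PW-SOS K = 3, n = 6 (results/rh-gaps-eng-2/W-23031-rh-gaps-eng-2/,
MANIFEST b2357bd6745aabce; exact rationals + 40-digit intervals; r̂ ≥ 0 on [1, 3) interval-verified,
≡ 0 beyond): c_fl ≥ 0.005681871 (referee ≡ 5.6853323e-3); eng-1 HG deg 11, s = 0.9004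
(results/rh-gaps-eng-1/R-aA3-E1-g0-01/cert, c23fa13a85839adc): c_fl = 0.0050283229 (referee ≡ 17
digits; genus-disjoint). Companions: (2, 4/5, 99/200) eng-2 -/
@[route_item "route-RiemannHypothesis-GapsEvoDoors"]
def DeltaCIFloorNineTenths : Prop :=
  ∃ (Δ lam f : ℝ) (r : ℝ → ℝ), 1 ≤ Δ ∧ 0 < lam ∧ lam < 1 / 2 ∧ f < 9 / 10 ∧ 0 ≤ f ∧ (∀ u : ℝ, r (-u) = r u) ∧ Continuous r ∧ MeasureTheory.Integrable r ∧ MeasureTheory.Integrable (Literature.NumberTheory.LFunctions.BGMM2023.cosTransform r) ∧ (∀ u : ℝ, r u ≤ 1) ∧ (∀ u : ℝ, lam < |u| → r u ≤ 0) ∧ (∀ α : ℝ, Δ ≤ |α| → 0 ≤ Literature.NumberTheory.LFunctions.BGMM2023.cosTransform r α) ∧ (∀ α : ℝ, 1 ≤ |α| → |α| ≤ Δ → 0 ≤ Literature.NumberTheory.LFunctions.BGMM2023.cosTransform r α) ∧ 0 < Literature.NumberTheory.LFunctions.BGMM2023.cosTransform r 0 - 1 + 2 * (∫ α in (0 : ℝ)..1,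 α * Literature.NumberTheory.LFunctions.BGMM2023.cosTransform r α) + 2 * f * (∫ α in (1 : ℝ)..Δ, Literature.NumberTheory.LFunctions.BGMM2023.cosTransform r α)

-- `DeltaCIFloorNineTenths` holds: proved by `Summit.RiemannHypothesis.RiemannHypothesis.Theorems.GapsEvoDoorsFloor.DeltaCIFloorNineTenths_holds` (its module imports this route file, so no `_holds` link can be stated here).

/-- item stmt-RiemannHypothesis-23032 · support · rank 9 · closed · proved by Summit.RiemannHypothesis.RiemannHypothesis.Theorems.GapsEvoDoorsWindow.FloorSpacingCriterionAll_holds (prover) · by planner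
sources: arXiv:2208.02359, Montgomery1973, arXiv:1406.5462
[support] LINE L11-a3 floor spacing criterion (cell `FloorSpacingCriterionAll`, expanded verbatim;
analytic support provable like FFSpacingCriterionAll — Montgomery's explicit formula under RH with
the ONE-SIDED floor in place of the two-sided fragment, BGMM 2023 Prop. 1 / Thm 3 scheme): for every
floor level f₀ and window Δ ≥ 1, if eventually F(α,T) ≥ f₀ − ε on 1 < |α| ≤ Δ (every ε > 0) and RH
holds, then every λ > 0, every 0 ≤ f < f₀ and every r ∈ 𝒜_Δ(λ) with r̂ ≥ 0 on 1 ≤ |α| ≤ Δ and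
c_fl(r;Δ,f) > 0 force SpacingDensityPos λ. GGOS (GRH) floor F ≥ 3/2 − |α| − ε on [1, 3/2] is NOT
enough by engine-1 (0.5763). Stub of the second registered skeleton on FragmentToCI; witness of the
companion search object DeltaCIFloorNineTenths is two-engine certified at (2, 17/20, 12/25) (referee
V-20). AVERAGE-FLOOR VARIANT (rh-idea-8 H-1; instrument rows eng-1 MONO-a 12102f535bc651df — r̂*
non-increasing on [1, Δ] in 156/164 cells, sole genuine exception FF(3, 0.1) — and eng-2
E2-mono-avgfloor 9f53c659ca3e3261 — monotone for every Δ ≤ 2 extremiser, false at Δ = 3): when r̂ is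
additionally non-increasing on [1, Δ], Abel summation lets the same proof consume only the
RUNNING-AVERAGE floor (1/(x − 1) -/
@[route_item "route-RiemannHypothesis-GapsEvoDoors"]
def FloorSpacingCriterionAll : Prop :=
  ∀ f₀ Δ : ℝ, 1 ≤ Δ → (∀ ε : ℝ, 0 < ε → ∃ T₀ : ℝ, ∀ T : ℝ, T₀ ≤ T → ∀ α : ℝ, 1 < |α| → |α| ≤ Δ → f₀ - ε ≤ Literature.NumberTheory.LFunctions.montgomeryFormFactor α T) → _root_.RiemannHypothesis → ∀ (lam f : ℝ) (r : ℝ → ℝ), 0 < lam → f < f₀ → 0 ≤ f → (∀ u : ℝ, r (-u) = r u) → Continuous r → MeasureTheory.Integrable r → MeasureTheory.Integrable (Literature.NumberTheory.LFunctions.BGMM2023.cosTransform r) → (∀ u : ℝ, r u ≤ 1) → (∀ u : ℝ, lam < |u| → r u ≤ 0) → (∀ α : ℝ, Δ ≤ |α| → 0 ≤ Literature.NumberTheory.LFunctions.BGMM2023.cosTransform r α) → (∀ α : ℝ, 1 ≤ |α| → |α| ≤ Δ → 0 ≤ Literature.NumberTheory.LFunctions.BGMM2023.cosTransform r α) → 0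 < Literature.NumberTheory.LFunctions.BGMM2023.cosTransform r 0 - 1 + 2 * (∫ α in (0 : ℝ)..1, α * Literature.NumberTheory.LFunctions.BGMM2023.cosTransform r α) + 2 * f * (∫ α in (1 : ℝ)..Δ, Literature.NumberTheory.LFunctions.BGMM2023.cosTransform r α) → Literature.NumberTheory.LFunctions.BGMM2023.SpacingDensityPos lam

-- `FloorSpacingCriterionAll` holds: proved by `Summit.RiemannHypothesis.RiemannHypothesis.Theorems.GapsEvoDoorsWindow.FloorSpacingCriterionAll_holds` (its module imports this route file, so no `_holds` link can be stated here).

/-- item stmt-RiemannHypothesis-23066 · aside · rank 9 · open · by planner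
sources: arXiv:2208.02359, arXiv:1810.08843, arXiv:1905.12123
[aside] door (a) CONJECTURED WALL (PREREG-GAPS-10 E12′.2; planner of record rh-gaps-plan; supersedes
FragmentCertificateWall8, dropped rev 7 as numerically false): no admissible two-sided certificate
exists at any window Δ ≤ 13/10 — for all Δ ∈ [1, 13/10], ε > 0, λ < 1/2 and r ∈ 𝒜_Δ(λ) (even,
continuous, integrable, r ≤ 1, r ≤ 0 off [−λ,λ], r̂ integrable, r̂ ≥ 0 for |α| ≥ Δ), c(r;Δ,ε) ≤ 0;
i.e. Δ_CI(ε) > 1.3 for every ε > 0, conjectured just below the engines' float optimum Δ_CI(0) =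
1.339 (eng-1/eng-2 grid of record V-9/V-10; certified witnesses exist at Δ ≥ 1.40: V-11/V-12).
BANKED CONTEXT: never staffed by engines or provers; a landing under Theorems/…/Negative/ only from
a margin-controlled DUAL certificate (referee Λ_dual); refutable by any certified witness at Δ ≤
1.3. computed ≠ proved; nothing here bears on the truth of RH. -/
@[route_item "route-RiemannHypothesis-GapsEvoDoors"]
def FragmentCertificateWall13 : Prop :=
  ∀ (Δ ε lam : ℝ) (r : ℝ → ℝ), 1 ≤ Δ → Δ ≤ 13 / 10 → 0 < ε → 0 < lam → lam < 1 / 2 → (∀ u : ℝ, r (-u) = r u) → Continuous r → MeasureTheory.Integrable r → MeasureTheory.Integrable (Literature.NumberTheory.LFunctions.BGMM2023.cosTransform r) → (∀ u : ℝ, r u ≤ 1) → (∀ u : ℝ, lam < |u| → r u ≤ 0) → (∀ α : ℝ, Δ ≤ |α| → 0 ≤ Literature.NumberTheory.LFunctions.BGMM2023.cosTransform r α) → Literature.NumberTheory.LFunctions.BGMM2023.cosTransform r 0 - 1 + 2 * (∫ α in (0 : ℝ)..1, α * Literature.NumberTheory.LFunctions.BGMM2023.cosTransform r α) + 2 * (∫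 α in (1 : ℝ)..Δ, ((1 - ε) * max (Literature.NumberTheory.LFunctions.BGMM2023.cosTransform r α) 0 - (1 + ε) * max (-Literature.NumberTheory.LFunctions.BGMM2023.cosTransform r α) 0)) ≤ 0

/-- item stmt-RiemannHypothesis-23129 · support · rank 9 · closed · proved by Summit.RiemannHypothesis.RiemannHypothesis.Theorems.GapsEvoDoorsFF.FFMultiplicityCriterionAll_holds (prover) · by planner
sources: Montgomery1973, arXiv:2208.02359, arXiv:1406.5462
[support] door (a″) «Δ_s» multiplicity criterion under a fragment (cell rh-gaps lines/Sketch.lean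
`FFMultiplicityCriterion Δ ε` for all windows, expanded verbatim over tree decls; PREREG-GAPS-7 /
ADDENDUM E11): for every Δ ≥ 1, ε ≥ 0, the fragment |F − 1| ≤ ε on 1 < |α| ≤ Δ and RH give, for
every admissible multiplicity majorant g (even, continuous, integrable, ĝ integrable, g ≥ 0, g(0) =
1, ĝ ≤ 0 for |α| ≥ Δ) and every η > 0, N*(T) ≤ (m(g;Δ,ε) + η) N(T) eventually, m(g;Δ,ε) = ĝ(0) +
2∫₀¹αĝ + 2∫₁^Δ((1+ε)ĝ⁺ − (1−ε)ĝ⁻). Montgomery 1973 pair-correlation argument (BGMM 2023 Prop. 1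
scheme) with the fragment; at Δ = 1 it is Montgomery's N* ≤ (4/3 + o(1))N with the Fejér pair.
Provable now (analytic support, M). computed ≠ proved; nothing here bears on the truth of RH. -/
@[route_item "route-RiemannHypothesis-GapsEvoDoors"]
def FFMultiplicityCriterionAll : Prop :=
  ∀ Δ ε : ℝ, 1 ≤ Δ → 0 ≤ ε → (∃ T₀ : ℝ, ∀ T : ℝ, T₀ ≤ T → ∀ α : ℝ, 1 < |α| → |α| ≤ Δ → |Literature.NumberTheory.LFunctions.montgomeryFormFactor α T - 1| ≤ ε) → _root_.RiemannHypothesis → ∀ g : ℝ → ℝ, (∀ u : ℝ, g (-u) = g u) → Continuous g → MeasureTheory.Integrable g → MeasureTheory.Integrable (Literature.NumberTheory.LFunctions.BGMM2023.cosTransform g) → (∀ u : ℝ, 0 ≤ g u) → g 0 = 1 → (∀ α : ℝ, Δ ≤ |α| → Literature.NumberTheory.LFunctions.BGMM2023.cosTransform g α ≤ 0) → ∀ η : ℝ, 0 < η → (∃ T₀ : ℝ, ∀ T : ℝ, T₀ ≤ T → (Literature.NumberTheory.LFunctions.BGMM2023.multPairCount T : ℝ) ≤ (Literature.NumberTheory.LFunctions.BGMM2023.cosTransform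 g 0 + 2 * (∫ α in (0 : ℝ)..1, α * Literature.NumberTheory.LFunctions.BGMM2023.cosTransform g α) + 2 * (∫ α in (1 : ℝ)..Δ, ((1 + ε) * max (Literature.NumberTheory.LFunctions.BGMM2023.cosTransform g α) 0 - (1 - ε) * max (-Literature.NumberTheory.LFunctions.BGMM2023.cosTransform g α) 0)) + η) * Literature.NumberTheory.LFunctions.zetaZeroCount T)

-- `FFMultiplicityCriterionAll` holds: proved by `Summit.RiemannHypothesis.RiemannHypothesis.Theorems.GapsEvoDoorsFF.FFMultiplicityCriterionAll_holds` (its module imports this route file, so no `_holds` link can be stated here).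

/-- item stmt-RiemannHypothesis-23130 · support · rank 9 · closed · proved by Summit.RiemannHypothesis.RiemannHypothesis.Theorems.GapsEvoDoorsSimple.SimpleFromNStar_holds (prover) · by planner
sources: arXiv:1406.5462, BuiHeathbrown2013, Titchmarsh1986
[support] counting bridge (provable now; Titchmarsh §14.34 / CGdL 2020 §1: Σ_{ρ simple} 1 ≥ 2N − N*;
tree `two_mul_sum_sub_sum_sq_le_card_filter_eq_one`,
`simpleZeroCount_eq_simpleCriticalZeroCount_of_rh`): on RH, N*(T) ≤ ν N(T) eventually ⇒ N₀ˢ(T) ≥ (2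
− ν − η) N(T) eventually for every η > 0. computed ≠ proved; nothing here bears on the truth of RH. -/
@[route_item "route-RiemannHypothesis-GapsEvoDoors"]
def SimpleFromNStar : Prop :=
  _root_.RiemannHypothesis → ∀ ν : ℝ, (∃ T₀ : ℝ, ∀ T : ℝ, T₀ ≤ T → (Literature.NumberTheory.LFunctions.BGMM2023.multPairCount T : ℝ) ≤ (ν) * Literature.NumberTheory.LFunctions.zetaZeroCount T) → ∀ η : ℝ, 0 < η → ∀ᶠ T : ℝ in Filter.atTop, (2 - ν - η) * (Literature.NumberTheory.LFunctions.zetaZeroCount T : ℝ) ≤ Literature.NumberTheory.LFunctions.simpleCriticalZeroCount T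

-- `SimpleFromNStar` holds: proved by `Summit.RiemannHypothesis.RiemannHypothesis.Theorems.GapsEvoDoorsSimple.SimpleFromNStar_holds` (its module imports this route file, so no `_holds` link can be stated here).

/-- item stmt-RiemannHypothesis-23131 · support · rank 9 · closed · proved by Summit.RiemannHypothesis.RiemannHypothesis.Theorems.GapsEvoDoorsMultCert.MultCertificateRecord_holds (prover) · by planner
sources: arXiv:2208.02359, arXiv:1406.5462, BuiHeathbrown2013
[support] door (a″) CERTIFICATE OF RECORD, instance (Δ_s, ν_s) = (53/50, 1293/1000) of the cell's
MultCertificate: an admissible multiplicity majorant g (even, continuous, integrable, ĝ integrable,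
g ≥ 0, g(0) = 1, ĝ ≤ 0 for |α| ≥ 53/50) with m(g; 53/50, ε) ≤ 1.293 + κε for all ε ≥ 0 (m is affine
non-decreasing in ε, so κ := 2∫₁^Δ|ĝ| and the content is m(g; 53/50, 0) ≤ 1.293). INSTRUMENT ROWS —
TWO CODE-DISJOINT ENGINES, REFEREE-RE-DERIVED (PREREG-GAPS-7 A2; referee V-14 / V-16 / V-17,
rh-gaps/results/referee/VERDICTS.md fc4007dd16a8ba3d): eng-1 R-aA2-E1-g0-01 (MANIFEST
0b698ac77844f4a6) HGM object supported at Δ = 1.055: m(1.055, 0) = 1.292899830701017343 and m(1.055,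
1/20) = 1.292881699530985051, interval-certified and re-derived to ≥ 20 digits (V-14; ĝ ≤ 0 beyond
1.055 with tangency; g ≥ 0), admissible for the window 53/50 with m non-increasing in the window;
eng-2 R-aA2-E2-g0-01 (MANIFEST cc9f898cc6abd2fa; custody VALID V-16) SOS object with supp ĝ =
[−1.06, 1.06]: m(1.06, 0) = 1.2904826 and m(1.06, 1/20) = 1.29058757062577235 EXACT RATIONALS
(R-aA2-E2-g0-01-cert 6942b8c1b229cd4e), ≡ referee exact re-derivation to 17 digits (V-17) ⇒ both
engines ≤ 1.2929 < 1.293 at ε ∈ {0, 1/20 -/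
@[route_item "route-RiemannHypothesis-GapsEvoDoors"]
def MultCertificateRecord : Prop :=
  ∃ g : ℝ → ℝ, (∀ u : ℝ, g (-u) = g u) ∧ Continuous g ∧ MeasureTheory.Integrable g ∧ MeasureTheory.Integrable (Literature.NumberTheory.LFunctions.BGMM2023.cosTransform g) ∧ (∀ u : ℝ, 0 ≤ g u) ∧ g 0 = 1 ∧ (∀ α : ℝ, ((53 / 50) : ℝ) ≤ |α| → Literature.NumberTheory.LFunctions.BGMM2023.cosTransform g α ≤ 0) ∧ ∃ κ : ℝ, 0 ≤ κ ∧ ∀ ε : ℝ, 0 ≤ ε → Literature.NumberTheory.LFunctions.BGMM2023.cosTransform g 0 + 2 * (∫ α in (0 : ℝ)..1, α * Literature.NumberTheory.LFunctions.BGMM2023.cosTransform g α) + 2 * (∫ α in (1 : ℝ)..(53 / 50), ((1 + ε) * max (Literature.NumberTheory.LFunctions.BGMM2023.cosTransform g α) 0 - (1 - ε) * max (-Literature.NumberTheory.LFunctions.BGMM2023.cosTransform g α) 0)) ≤ (1293 / 1000) + κ * ε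

-- `MultCertificateRecord` holds: proved by `Summit.RiemannHypothesis.RiemannHypothesis.Theorems.GapsEvoDoorsMultCert.MultCertificateRecord_holds` (its module imports this route file, so no `_holds` link can be stated here).

/-- item stmt-RiemannHypothesis-23132 · aside · rank 9 · closed · proved by Summit.RiemannHypothesis.RiemannHypothesis.Theorems.GapsEvoDoorsSimpleRecord.FragmentToSimpleRecord_holds (prover) · by planner
sources: BuiHeathbrown2013, Montgomery1973, arXiv:1406.5462
[aside] door (a″) LINE OF RECORD «Δ_s» (PREREG-GAPS-7 target A2; RECORD class, banked, never
staffed, not in the cone of closes): RH + the GUE pair-correlation fragment F → 1 on 1 < |α| ≤ 53/50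
= 1.06 (every tolerance) ⇒ at least 70.4 % of the zeros are simple and on the critical line — above
the RH record 19/27 = 70.37 % (Bui–Heath-Brown 2013) with a window only 6 % beyond Montgomery's
theorem. ENGINE RECORD (two engines): Δ_s(0) = 1.05 FLOAT (eng-1 BLM) / 1.0506 (eng-2 SOS), |Δ| ≤
1.6e-3; ≤ 1.055 CERTIFIED (eng-1 HGM + referee re-derivation V-14); exact-rational certificate 2 −
ν(1.0506, 0) = 0.7040037 ≥ 19/27 + 1e-4 (eng-2); record instance filed at 53/50 where BOTH engines
certify m ≤ 1.293; Fejér-window bound √(9/8) = 1.0607; ν is ε-insensitive (Fourier mass inside [−1,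
1]). Follows from MultCertificateRecord + FFMultiplicityCriterionAll + SimpleFromNStar by the
kernel-checked composition fragmentToSimpleRecord_of (rh-idea-8 E116_Sketch.lean; cell copy with
record numbers rc 0). computed ≠ proved; nothing here bears on the truth of RH. -/
@[route_item "route-RiemannHypothesis-GapsEvoDoors"]
def FragmentToSimpleRecord : Prop :=
  (∀ ε : ℝ, 0 < ε → (∃ T₀ : ℝ, ∀ T : ℝ, T₀ ≤ T → ∀ α : ℝ, 1 < |α| → |α| ≤ (53 / 50) → |Literature.NumberTheory.LFunctions.montgomeryFormFactor α T - 1| ≤ ε)) → _root_.RiemannHypothesis → ∀ η : ℝ, 0 < η → ∀ᶠ T : ℝ in Filter.atTop, ((704 / 1000) - η) * (Literature.NumberTheory.LFunctions.zetaZeroCount T : ℝ) ≤ Literature.NumberTheory.LFunctions.simpleCriticalZeroCount T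

-- `FragmentToSimpleRecord` holds: proved by `Summit.RiemannHypothesis.RiemannHypothesis.Theorems.GapsEvoDoorsSimpleRecord.FragmentToSimpleRecord_holds` (its module imports this route file, so no `_holds` link can be stated here).

/-- item stmt-RiemannHypothesis-22424 · assembly · rank 1 · closed · proved by Summit.RiemannHypothesis.RiemannHypothesis.Theorems.GapsEvoDoorsAssembly.Assembly_holds (prover) · by planner
sources: arXiv:2208.02359, arXiv:2604.05733, ConreyIwaniec2002
[assembly] for every φ ≤ 0.50884 and Δ ≥ 1: (Inoue Thm 2 → RH → μ ≤ φ) → (fragment on (1,Δ] → RH →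
close pair below 2001 → CI (1.22)) → DoorsResidual → RH. -/
@[route_item "route-RiemannHypothesis-GapsEvoDoors"]
def Assembly : Prop :=
  ∀ φ Δ : ℝ, φ ≤ 0.50884 → (Literature.NumberTheory.LFunctions.inoue2026_theorem2 → _root_.RiemannHypothesis → Literature.NumberTheory.LFunctions.ZetaGapLiminfLe φ) → 1 ≤ Δ → ((∀ ε : ℝ, 0 < ε → ∃ T₀ : ℝ, ∀ T : ℝ, T₀ ≤ T → ∀ α : ℝ, 1 < |α| → |α| ≤ Δ → |Literature.NumberTheory.LFunctions.montgomeryFormFactor α T - 1| ≤ ε) → _root_.RiemannHypothesis → (Literature.NumberTheory.LFunctions.closeCriticalZeros 2001).Nonempty → ∃ c : ℝ, 0 < c ∧ Literature.NumberTheory.LFunctions.SubnormalGapsHypothesis c) → DoorsResidual → Summit.RiemannHypothesis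

-- `Assembly` holds: proved by `Summit.RiemannHypothesis.RiemannHypothesis.Theorems.GapsEvoDoorsAssembly.Assembly_holds` (its module imports this route file, so no `_holds` link can be stated here).

/-! D-0027 §2.1 — DECIDING THEOREM (planner-authored via `route open/edit --closes-file`; by planner-rh-idea-8-g0-0 2026-08-27T20:48:57Z):
its hypotheses are this route's items and its conclusion the sub-problem Statement (glue_lint), and it elaborates with this file. -/

@[closes "route-RiemannHypothesis-GapsEvoDoors"] theorem closes (hk : DeltaCIFinite) (hcrit : FFSpacingCriterionAll) (hb : SpacingToCI)
    (h₃ : InOptRung) (hR : DoorsResidual) : Summit.RiemannHypothesis := by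
  refine hR h₃ ?_
  obtain ⟨Δ, ε, lam, r, hΔ, hε, h0, h1, hev, hco, hin, htr, hle, hno, htail, hc⟩ := hk
  refine ⟨Δ, hΔ, fun hFF hRH h₀ => ?_⟩
  exact hb hRH lam h0.le h1
    (hcrit Δ ε hΔ hε.le (hFF ε hε) hRH lam r h0 hev hco hin htr hle hno htail hc) h₀

end Summit.RiemannHypothesis.RiemannHypothesis.Theses.GapsEvoDoors
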